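import Literature.MathematicalPhysics.QuantumFieldTheory.Balaban1983to89.B13OpsYPencilDeltaPrime
import Literature.MathematicalPhysics.QuantumFieldTheory.Balaban1983to89.B13InverseOperatorCoordinates

/-!
# `Balaban1983to89.B13OpsYPencilGreenPrime` — T. Bałaban, *Propagators for lattice gauge theories in a background field*, Commun. Math. Phys.
**99** (1985) 389–434 [Balaban1985BackgroundPropagators], (3.24)–(3.25) pp. 394–395 («Its inverse is denoted by G′, or G′(U)»), Thm 3.1 (3.42) p. 397,
Thm 3.4 p. 400 («the operators … extend to configurations U′U … as analytic functions of A′ … G′(U′U)»), Sect. B (3.60)–(3.65) p. 402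
(«G′(U′U) = G′(U)(I − V′(A)G′(U))⁻¹ = Σₙ G′(U)(V′(A)G′(U))ⁿ») and p. 403 ll. 3–5, Thm 3.10 (3.107)–(3.108) p. 416; *Renormalization group approach to
lattice gauge field theories. II*, Commun. Math. Phys. **116** (1988) 1–22 [Balaban1988RG2Cluster] (2.5)–(2.7) pp. 12–13, p. 15: THE G′-JUNCTION —
NODE 00's PROPAGATOR `G′(e^{iηA′}U₀) = (Δ′_a(e^{iηA′}U₀))⁻¹` IN THE N10 ENTRY-LETTER CURRENCY ALONG pv27's PENCIL, MODULO N06's THEOREM 3.1 ∕ 3.10 AT THE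
ONE REAL BACKGROUND `U₀` ONLY.

The FIRST inverse of print's chain `G′ → (Q′G′²Q′*)⁻¹ → G`.  Its un-inverted operator `Δ′_a(U) = Δ_U + Σ_j a_j(L^jη)^{−2}Q′_j(U)*Q′_j(U)` (3.24) is
LOCAL; the lane's module 74 (`B13OpsYPencilDeltaPrime`, dag-n10-c g14) proves its N10 coordinates `A′ ↦ φ_k((Δ′_a(e^{iηA′}U₀)(δ_x ⊗ e_l))(z))`
HOLOMORPHIC on every chart ball and BOUNDED (`norm_deltaPrimeAY_prodCfg_le`).  THIS FILE (width seat n10-w2 g2, CLAIM-5 «the G′-junction»; dag-lead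
WIDTH-207: «N10 … the pencil ∕ G′-junction files w1–w4 hold») adds the two missing readings and composes:
* §1 LOCALITY of `Δ′_a(U)` ON ONE-SITE FIELDS, any `U`, any transporter letter `par` (pure unfolding of NODE 00's `cdS ∕ cdsS ∕ lapS ∕ kernelTrOpY`):
  `cdS_single_eq_zero`, `lapS_single_eq_zero`, `deltaPrimeAY_single_apply`, ★ `deltaPrimeAY_single_eq_zero` — `(Δ′_a(U)(δ_x ⊗ E))(z) = 0` unless `z = x`,
  `z ± e_μ = x`, or `avgCoeff(z,x) ≠ 0` (same averaging block).
* §2 THE RANGE READ THROUGH A LOCATION MAP `ℓ : SiteY i → UT Nf` into [13]'s unit torus (NODE 00's dictionary; its two numerals displayed: one lattice step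
  reads as `ℓ`-distance `≤ s`, a non-zero averaging coefficient as `≤ s`): ★ `tdist_le_of_deltaPrimeAY_single_ne_zero`.
* §3 ★★ THE SQUARE `RawEntryLetters` PACKAGING `rawEntryLetters_toMatrix_deltaPrimeAY_prodCfg` — for a ℂ-basis `b` of `𝔸` with numerals `cb` (`‖b.repr a k‖ ≤
  cb‖a‖`), `cl` (`‖b_l‖ ≤ cl`): `RawEntryLetters (A′ ↦ toMatrix B′ B′ (Δ′_a(e^{iηA′}U₀))) (ℓ ∘ fst) Rc ρ (cb·M(cl)·e^{ρs})` for EVERY `ρ ≥ 0`, where `M(cl)` is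
  74's majorant at `‖Λ‖ = cl` with the row-sum numeral `Cavg ≥ Σ_w |avgCoeff(z,w)|` (56A `rawEntryLetters_of_range_family` + 74 §4 + §2 + p599011
  `rawEntryLetters_toMatrix_of_coordFamily`; the coordinate functionals are made continuous by `LinearMap.mkContinuous` from `cb` — no finite-dimension
  instance is assumed).
* §4 ★★★ `rawEntryLetters_toMatrix_GpY_prodCfg_of_pencil` — THE G′-JUNCTION: §3 fed to `B13InverseOperatorCoordinates` §5
  (`rawEntryLetters_toMatrix_ringInverse_located_of_kernelBound`, `prodCfg_zero`, `deltaPrimeAY_mul_GpY`) ⟹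
  `RawEntryLetters (A′ ↦ toMatrix B′ B′ (G′(e^{iηA′}U₀))) (ℓ ∘ fst) R₁⋆ ρ′ (2·cb·cl·B_G)` at the located thin radius, for every target rate `0 ≤ ρ′ < ρ`,
  DISPLAYING ONLY: (N06) `IsUnit (Δ′_a(U₀))` and the pointwise (3.108)-type bound `‖G′(U₀)(δ_x ⊗ E)(y)‖ ≤ B_G‖E‖e^{−ρ d(ℓy,ℓx)}` at the ONE real background
  `U₀` — Theorem 3.1 ∕ 3.10, GAPS G-B9-05∕06a∕07 —; (NODE 00) the background's size `K₀`, the averaging support numerals `D`, `Cavg`, the reading numerals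
  `s`; the basis numerals; a fibre bound of `ℓ`.  No `μ`, no `R₁`, no smallness, no complexification hypothesis: Sect. B's (3.62)–(3.64) for `G′` at NODE 00's
  objects of record.
HONEST FRAMING: readers + located numerals + [folklore] unfolding; Theorem 3.1 ∕ 3.10 at the centre is N06's displayed content; which `ℓ`, `b`, `U₀`, `η` are
«of record» is NODE 00's ∕ def-Y's ∕ def-T's word; nothing of Bałaban's is asserted; NODE 00's `deltaPrimeAY ∕ GpY ∕ parSY ∕ cdS ∕ cdsS ∕ lapS ∕ avgCoeffY ∕
avgTrY` and pv27's `prodCfg` CONSUMED BY NAME, nothing of `Node00/OpsY*` modified; N06 ∕ N10 NOT discharged; K1⁷ NOT closed; counts unmoved (typed 28∕28 ·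
discharged 5∕27); THEOREMS ONLY, 0 `sorry`, standard axioms; one finite 𝕋⁴ programme at fixed ε — R4 closes the conditional finite-𝕋⁴ rung
`BalabanLadder.UV` only; the YM mass gap (Clay) is NOT proved by any of this; nothing continuum ∕ ℝ⁴ ∕ OS.

References: T. Bałaban, CMP 99 (1985) 389–434 [Balaban1985BackgroundPropagators] (3.3) p.390, (3.8) p.392, (3.23)–(3.25) pp.394–395, Thm 3.1 (3.42)
p.397, Thm 3.4 and (3.50) p.400, (3.60)–(3.65) p.402, p.403 ll.3–5, Thm 3.10 (3.107)–(3.108) pp.415–416; CMP 116 (1988) 1–22 [Balaban1988RG2Cluster]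
(2.5)–(2.7) pp.12–13, p.15; CMP 96 (1984) 223–250 [Balaban1984PropagatorsII] (2.13)–(2.14) p.225, Lemma 2.1 (2.61) p.234.
-/

noncomputable section

namespace Literature.MathematicalPhysics.QuantumFieldTheory.Balaban1983to89.B13OpsYPencilGreenPrime

open Metric Set Finset Module
open scoped Matrix
open Literature.MathematicalPhysics.QuantumFieldTheory.Balaban1983to89
open Literature.MathematicalPhysics.QuantumFieldTheory.Balaban1983to89.B9Thm37GlueTorus (tdist1 tdist1_comm tdist1_self tdist1_nonneg)
open Literature.MathematicalPhysics.QuantumFieldTheory.Balaban1983to89.B5TorusCover (UT)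
open Literature.MathematicalPhysics.QuantumFieldTheory.Balaban1983to89.B13EntrywiseWalks (RawEntryLetters)
open Literature.MathematicalPhysics.QuantumFieldTheory.Balaban1983to89.B13AccretiveOfRealCoercive (rawEntryLetters_of_range_family)
open Literature.MathematicalPhysics.QuantumFieldTheory.Balaban1983to89.B13InverseOperatorCoordinates
  (toMatrix_piProd_apply rawEntryLetters_toMatrix_of_coordFamily rawEntryLetters_toMatrix_ringInverse_located_of_kernelBound)
open Literature.MathematicalPhysics.QuantumFieldTheory.Balaban1983to89.B13OpsYPencilDeltaPrime
  (cdS_apply cdsS_apply lapS_apply differentiableOn_coord_deltaPrimeAY_prodCfg norm_deltaPrimeAY_prodCfg_le)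
open Literature.MathematicalPhysics.QuantumFieldTheory.Balaban1983to89.B9Eq39Adjoint (R R_def R_zero prodCfg)
open Literature.MathematicalPhysics.QuantumFieldTheory.Balaban1983to89.B9Eq369Product (prodCfg_zero)
open Literature.MathematicalPhysics.QuantumFieldTheory.Balaban1983to89.B6GlobalChartV1 (PV boxEquiv)
open Literature.MathematicalPhysics.QuantumFieldTheory.Balaban1983to89.B6KLevelCensusIndexV1 (KIdx)
open Literature.MathematicalPhysics.QuantumFieldTheory.Balaban1983to89.Node00

variable {𝔸 : Type} [NormedRing 𝔸] [NormedAlgebra ℂ 𝔸] [CompleteSpace 𝔸]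
variable {d ℓ : ℕ} {hd : 1 ≤ d + 1} {hL : Odd (ℓ + 1) ∧ 1 < ℓ + 1} {b₀ b₁ : ℝ}
variable (i : KIdx d ℓ hd hL b₀ b₁)

/-! ## §1. Locality of `Δ′_a(U)` on one-site fields (any `U`, any transporter letter) -/

section Locality

variable [DecidableEq (SiteY i)]

/-- `(∇_{U,μ}(δ_x ⊗ E))(z) = 0` unless `z = x` or `z + e_μ = x`. [cite: Balaban1985BackgroundPropagators, (3.3) p.390] -/
theorem cdS_single_eq_zero (U : CfgY 𝔸 i) (μ : Fin (d + 1)) (x z : SiteY i) (E : 𝔸) (hz : z ≠ x) (hs : shiftY i μ z ≠ x) :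
    cdS i U μ (Pi.single x E) z = 0 := by
  rw [cdS_apply, Pi.single_eq_of_ne hs, Pi.single_eq_of_ne hz, R_zero, sub_zero]

/-- `(Δ_U(δ_x ⊗ E))(z) = 0` unless `z = x`, `z + e_μ = x` or `z − e_μ = x` for some `μ`. [cite: Balaban1985BackgroundPropagators, (3.23) p.395] -/
theorem lapS_single_eq_zero (U : CfgY 𝔸 i) (x z : SiteY i) (E : 𝔸) (hz : z ≠ x) (hfwd : ∀ μ, shiftY i μ z ≠ x)
    (hbwd : ∀ μ, (shiftY i μ).symm z ≠ x) : lapS i U (Pi.single x E) z = 0 := by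
  rw [lapS_apply]
  refine Finset.sum_eq_zero fun μ _ => ?_
  have h1 : cdS i U μ (Pi.single x E) ((shiftY i μ).symm z) = 0 :=
    cdS_single_eq_zero i U μ x _ E (hbwd μ) (by rw [Equiv.apply_symm_apply]; exact hz)
  rw [cdsS_apply, h1, cdS_single_eq_zero i U μ x z E hz (hfwd μ), R_zero, sub_zero]

/-- `Δ′_a(U)` on a one-site field, unfolded: the Laplacian part plus the single averaging term `avgCoeff(z,x)·R(avgTr(z,x))E`.
[cite: Balaban1985BackgroundPropagators, (3.24) p.394] -/
theorem deltaPrimeAY_single_apply (par : SiteParY 𝔸 i) (U : CfgY 𝔸 i) (x z : SiteY i) (E : 𝔸) :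
    deltaPrimeAY i par U (Pi.single x E) z = lapS i U (Pi.single x E) z + ((avgCoeffY i z x : ℝ) : ℂ) • R (avgTrY i par U z x) E := by
  rw [deltaPrimeAY_apply, Finset.sum_eq_single x (fun w _ hw => by rw [Pi.single_eq_of_ne hw, R_zero, smul_zero])
    (fun h => absurd (Finset.mem_univ x) h), Pi.single_eq_same]

/-- ★ **LOCALITY OF `Δ′_a(U)`**: `(Δ′_a(U)(δ_x ⊗ E))(z) = 0` unless `z = x`, `z ± e_μ = x` for some `μ`, or `avgCoeff(z,x) ≠ 0` (same averaging block).
[cite: Balaban1985BackgroundPropagators, (3.23)–(3.24) pp.394–395; Balaban1984PropagatorsII, (2.13)–(2.14) p.225] -/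
theorem deltaPrimeAY_single_eq_zero (par : SiteParY 𝔸 i) (U : CfgY 𝔸 i) (x z : SiteY i) (E : 𝔸) (hz : z ≠ x)
    (hfwd : ∀ μ, shiftY i μ z ≠ x) (hbwd : ∀ μ, (shiftY i μ).symm z ≠ x) (havg : avgCoeffY i z x = 0) :
    deltaPrimeAY i par U (Pi.single x E) z = 0 := by
  rw [deltaPrimeAY_single_apply, lapS_single_eq_zero i U x z E hz hfwd hbwd, havg, Complex.ofReal_zero, zero_smul, add_zero]

end Locality

/-! ## §2. The range read through a location map into [13]'s unit torus -/

section Range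

variable [DecidableEq (SiteY i)]
variable {ν : ℕ} {Nf : Fin ν → ℕ} [∀ j, NeZero (Nf j)]

/-- ★ **THE RANGE OF `Δ′_a(U)` THROUGH A READING** `ℓ : SiteY i → UT Nf`: if one lattice step reads as `ℓ`-distance `≤ s` and a non-zero averaging coefficient
as `≤ s` (`s ≥ 0`; NODE 00's dictionary numerals, displayed), then `(Δ′_a(U)(δ_x ⊗ E))(z) ≠ 0 ⇒ d₁(ℓ z, ℓ x) ≤ s`.
[cite: Balaban1985BackgroundPropagators, (3.24) p.394, (3.107)–(3.108) p.416; Balaban1988RG2Cluster, (2.5) p.12] -/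
theorem tdist_le_of_deltaPrimeAY_single_ne_zero (ℓ' : SiteY i → UT Nf) {s : ℝ} (hs0 : 0 ≤ s)
    (hℓ : ∀ μ z, tdist1 Nf (ℓ' (shiftY i μ z)) (ℓ' z) ≤ s) (hℓa : ∀ z w, avgCoeffY i z w ≠ 0 → tdist1 Nf (ℓ' z) (ℓ' w) ≤ s)
    {par : SiteParY 𝔸 i} {U : CfgY 𝔸 i} {x z : SiteY i} {E : 𝔸} (h : deltaPrimeAY i par U (Pi.single x E) z ≠ 0) :
    tdist1 Nf (ℓ' z) (ℓ' x) ≤ s := by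
  by_cases hz : z = x
  · rw [hz, tdist1_self]; exact hs0
  by_cases hfwd : ∃ μ, shiftY i μ z = x
  · obtain ⟨μ, hμ⟩ := hfwd
    rw [← hμ, tdist1_comm]; exact hℓ μ z
  by_cases hbwd : ∃ μ, (shiftY i μ).symm z = x
  · obtain ⟨μ, hμ⟩ := hbwd
    have e : z = shiftY i μ x := by rw [← hμ, Equiv.apply_symm_apply]
    rw [e]; exact hℓ μ x
  by_cases havg : avgCoeffY i z x = 0
  · simp only [not_exists] at hfwd hbwd
    exact absurd (deltaPrimeAY_single_eq_zero i par U x z E hz hfwd hbwd havg) h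
  · exact hℓa z x havg

end Range

/-! ## §3. ★★ The square `RawEntryLetters` packaging of `A′ ↦ toMatrix B′ B′ (Δ′_a(e^{iηA′}U₀))` along the pencil -/

section Packaging

variable [NormOneClass 𝔸] [DecidableEq (SiteY i)]
variable {ν : ℕ} {Nf : Fin ν → ℕ} [∀ j, NeZero (Nf j)]
variable {κ : Type} [Fintype κ] [DecidableEq κ] (b : Basis κ ℂ 𝔸)
variable (U₀ : CfgY 𝔸 i) (η : ℝ) {Rc K₀ : ℝ} {D : ℕ}

/-- ★★ **`Δ′_a` ALONG THE PENCIL AS AN N10 LETTER DATUM** (square case, index `SiteY i × κ`, locations `(z,k) ↦ ℓ z`): for EVERY `ρ ≥ 0`,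
`RawEntryLetters (A′ ↦ toMatrix B′ B′ (Δ′_a(e^{iηA′}U₀))) (ℓ ∘ fst) Rc ρ (cb·M·e^{ρs})` with `M` = 74's majorant at `‖Λ‖ = cl` and row sum `Cavg`.  Inputs:
the background's size (`‖U₀(b)^{±1}‖ ≤ K₀`, `1 ≤ K₀`), `0 ≤ Rc`, 74's support-length numeral `D` of the averaging transport, the row-sum numeral
`Cavg ≥ Σ_w |avgCoeff(z,w)|` (`Cavg ≥ 0`), the basis numerals `cb, cl ≥ 0`, the reading numerals of §2.  Holomorphy: 74 `differentiableOn_coord_deltaPrimeAY_prodCfg`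
(at `φ_k := (b.coord k).mkContinuous cb`); bound: 74 `norm_deltaPrimeAY_prodCfg_le`; range: §2; packaging: 56A `rawEntryLetters_of_range_family`.
[cite: Balaban1985BackgroundPropagators, (3.24) p.394, Thm 3.4 and (3.50) p.400, Thm 3.10 (3.107)–(3.108) p.416; Balaban1988RG2Cluster, (2.5) p.12, p.15] -/
theorem rawEntryLetters_toMatrix_deltaPrimeAY_prodCfg
    (hU : ∀ μ x, ‖(U₀ μ x : 𝔸)‖ ≤ K₀) (hUi : ∀ μ x, ‖(((U₀ μ x)⁻¹ : 𝔸ˣ) : 𝔸)‖ ≤ K₀) (hK1 : 1 ≤ K₀) (hRc : 0 ≤ Rc)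
    (hD : ∀ z w, avgCoeffY i z w ≠ 0 →
      Site.tdist ((boxEquiv i.hN).symm z) ((boxEquiv i.hN).symm (cornerY i (levY i z) z)) +
        Site.tdist ((boxEquiv i.hN).symm (cornerY i (levY i z) z)) ((boxEquiv i.hN).symm w) ≤ D)
    {Cavg : ℝ} (hCavg0 : 0 ≤ Cavg) (hCavg : ∀ z, ∑ w, |avgCoeffY i z w| ≤ Cavg)
    {cb cl : ℝ} (hcb : ∀ (a : 𝔸) (k : κ), ‖b.repr a k‖ ≤ cb * ‖a‖) (hcb0 : 0 ≤ cb) (hcl : ∀ l, ‖b l‖ ≤ cl) (hcl0 : 0 ≤ cl)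
    (ℓ' : SiteY i → UT Nf) {s : ℝ} (hs0 : 0 ≤ s)
    (hℓ : ∀ μ z, tdist1 Nf (ℓ' (shiftY i μ z)) (ℓ' z) ≤ s) (hℓa : ∀ z w, avgCoeffY i z w ≠ 0 → tdist1 Nf (ℓ' z) (ℓ' w) ≤ s)
    {ρ : ℝ} (hρ : 0 ≤ ρ) :
    RawEntryLetters (fun a : Fin (d + 1) → Site (PV d ℓ i.m i.K hd hL) 0 → 𝔸 =>
        LinearMap.toMatrix ((Pi.basis fun _ : SiteY i => b).reindex (Equiv.sigmaEquivProd (SiteY i) κ))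
          ((Pi.basis fun _ : SiteY i => b).reindex (Equiv.sigmaEquivProd (SiteY i) κ)) (deltaPrimeAY i (parSY i) (prodCfg U₀ η a)))
      (fun p : SiteY i × κ => ℓ' p.1) Rc ρ
      (cb * (((d : ℝ) + 1) *
          (K₀ * Real.exp (|η| * Rc) * (K₀ * Real.exp (|η| * Rc) * cl * (K₀ * Real.exp (|η| * Rc)) + cl) * (K₀ * Real.exp (|η| * Rc)) +
            (K₀ * Real.exp (|η| * Rc) * cl * (K₀ * Real.exp (|η| * Rc)) + cl)) +
          Cavg * ((K₀ * Real.exp (|η| * Rc)) ^ D * cl * (K₀ * Real.exp (|η| * Rc)) ^ D)) * Real.exp (ρ * s)) := by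
  -- the coordinate functionals as continuous linear maps, from the numeral `cb`
  set φ : κ → 𝔸 →L[ℂ] ℂ := fun k => (b.coord k).mkContinuous cb (fun a => by rw [Basis.coord_apply]; exact hcb a k) with hφ
  have hφapp : ∀ k (a : 𝔸), φ k a = b.coord k a := fun k a => LinearMap.mkContinuous_apply _ _ _ _
  set Kη : ℝ := K₀ * Real.exp (|η| * Rc) with hKη
  have hK0 : 0 ≤ K₀ := zero_le_one.trans hK1
  have hKη0 : 0 ≤ Kη := mul_nonneg hK0 (Real.exp_nonneg _)
  -- 74's majorant is linear in `‖Λ‖` and in the row sum: factor it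
  have eP : ∀ t S : ℝ, ((d : ℝ) + 1) * (Kη * (Kη * t * Kη + t) * Kη + (Kη * t * Kη + t)) + S * (Kη ^ D * t * Kη ^ D) =
      t * (((d : ℝ) + 1) * ((Kη * Kη + 1) * (Kη * Kη + 1))) + S * t * (Kη ^ D * Kη ^ D) := by
    intro t S; ring
  have hA₁ : 0 ≤ ((d : ℝ) + 1) * ((Kη * Kη + 1) * (Kη * Kη + 1)) :=
    mul_nonneg (by positivity) (mul_nonneg (by nlinarith [mul_nonneg hKη0 hKη0]) (by nlinarith [mul_nonneg hKη0 hKη0]))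
  have hA₂ : 0 ≤ Kη ^ D * Kη ^ D := mul_nonneg (pow_nonneg hKη0 _) (pow_nonneg hKη0 _)
  have hM0 : 0 ≤ ((d : ℝ) + 1) * (Kη * (Kη * cl * Kη + cl) * Kη + (Kη * cl * Kη + cl)) + Cavg * (Kη ^ D * cl * Kη ^ D) := by
    rw [eP]
    exact add_nonneg (mul_nonneg hcl0 hA₁) (mul_nonneg (mul_nonneg hCavg0 hcl0) hA₂)
  refine rawEntryLetters_toMatrix_of_coordFamily b (fun a => deltaPrimeAY i (parSY i) (prodCfg U₀ η a)) ?_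
  refine rawEntryLetters_of_range_family (fun p q => ?_) hρ (mul_nonneg hcb0 hM0) (fun u _ p q hne => ?_) (fun u hu p q => ?_)
  · -- holomorphy: 74 §4 at `φ_k := (b.coord k).mkContinuous cb`
    exact (differentiableOn_coord_deltaPrimeAY_prodCfg i U₀ η φ b p.1 q.1 p.2 q.2).congr fun u _ => (hφapp p.2 _).symm
  · -- range: §2
    refine tdist_le_of_deltaPrimeAY_single_ne_zero i ℓ' hs0 hℓ hℓa (par := parSY i) (U := prodCfg U₀ η u) (E := b q.2) fun h0 => hne ?_
    rw [h0, map_zero]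
  · -- bound: `cb` × 74's majorant at `‖Λ‖ = ‖δ_x ⊗ b_l‖ = ‖b_l‖ ≤ cl`, row sum `≤ Cavg`
    have hΛ : ‖(Pi.single q.1 (b q.2) : SiteY i → 𝔸)‖ ≤ cl := by rw [Pi.norm_single]; exact hcl q.2
    have hSz : ∑ w, |avgCoeffY i p.1 w| ≤ Cavg := hCavg p.1
    have hSz0 : 0 ≤ ∑ w, |avgCoeffY i p.1 w| := Finset.sum_nonneg fun w _ => abs_nonneg _
    have h74 := norm_deltaPrimeAY_prodCfg_le i U₀ η hU hUi hK1 hRc hD (Pi.single q.1 (b q.2)) hu p.1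
    have hmono : ((d : ℝ) + 1) * (Kη * (Kη * ‖(Pi.single q.1 (b q.2) : SiteY i → 𝔸)‖ * Kη + ‖(Pi.single q.1 (b q.2) : SiteY i → 𝔸)‖) * Kη +
          (Kη * ‖(Pi.single q.1 (b q.2) : SiteY i → 𝔸)‖ * Kη + ‖(Pi.single q.1 (b q.2) : SiteY i → 𝔸)‖)) +
        (∑ w, |avgCoeffY i p.1 w|) * (Kη ^ D * ‖(Pi.single q.1 (b q.2) : SiteY i → 𝔸)‖ * Kη ^ D) ≤
        ((d : ℝ) + 1) * (Kη * (Kη * cl * Kη + cl) * Kη + (Kη * cl * Kη + cl)) + Cavg * (Kη ^ D * cl * Kη ^ D) := by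
      rw [eP, eP]
      exact add_le_add (mul_le_mul_of_nonneg_right hΛ hA₁)
        (mul_le_mul_of_nonneg_right (mul_le_mul hSz hΛ (norm_nonneg _) hCavg0) hA₂)
    calc ‖b.coord p.2 (deltaPrimeAY i (parSY i) (prodCfg U₀ η u) (Pi.single q.1 (b q.2)) p.1)‖
        ≤ cb * ‖deltaPrimeAY i (parSY i) (prodCfg U₀ η u) (Pi.single q.1 (b q.2)) p.1‖ := by
          rw [Basis.coord_apply]; exact hcb _ _
      _ ≤ cb * (((d : ℝ) + 1) * (Kη * (Kη * cl * Kη + cl) * Kη + (Kη * cl * Kη + cl)) + Cavg * (Kη ^ D * cl * Kη ^ D)) :=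
          mul_le_mul_of_nonneg_left (h74.trans hmono) hcb0

end Packaging

/-! ## §4. ★★★ THE G′-JUNCTION: `G′(e^{iηA′}U₀)` in N10 coordinates, modulo N06's Theorem 3.1 ∕ 3.10 at `U₀` only -/

section GreenPrime

variable [NormOneClass 𝔸] [DecidableEq (SiteY i)]
variable {ν : ℕ} {Nf : Fin ν → ℕ} [∀ j, NeZero (Nf j)]
variable {κ : Type} [Fintype κ] [DecidableEq κ] (b : Basis κ ℂ 𝔸)
variable (U₀ : CfgY 𝔸 i) (η : ℝ) {Rc K₀ : ℝ} {D : ℕ}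

/-- ★★★ **THE G′-JUNCTION — SECT. B's (3.62)–(3.64) FOR `G′` AT NODE 00's OBJECTS OF RECORD.**  Along pv27's pencil `A′ ↦ e^{iηA′}U₀`, the matrices of
NODE 00's propagator `G′ = (Δ′_a)⁻¹` (`Node00.GpY i (parSY i)`) in the product basis have the N10 letters
`RawEntryLetters (A′ ↦ toMatrix B′ B′ (G′(e^{iηA′}U₀))) (ℓ ∘ fst) R₁⋆ ρ′ (2·cb·cl·B_G)` at the located thin radius
`R₁⋆ = Rc ∕ (4·B_Δ·(cb·cl·B_G)·(m·c₀(1,(ρ−ρ′)∕3)^ν)² + 1)` (`B_Δ` = §3's constant at rate `ρ`), for every target rate `0 ≤ ρ′ < ρ`.  DISPLAYED INPUTS ONLY: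
(N06, GAPS G-B9-05∕06a∕07) `IsUnit (Δ′_a(U₀))` and Theorem 3.1 ∕ 3.10's pointwise (3.108)-type bound `‖G′(U₀)(δ_x ⊗ E)(y)‖ ≤ B_G‖E‖e^{−ρ d(ℓy,ℓx)}` at the
ONE real background; (NODE 00) the background's size `K₀`, the averaging numerals `D`, `Cavg`, the reading numerals `s`; the basis numerals `cb`, `cl`; a
fibre bound `m` of `ℓ`; `0 < Rc`.  No rate `μ`, no radius `R₁`, no smallness binder, no complexification hypothesis.
[cite: Balaban1985BackgroundPropagators, (3.24)–(3.25) pp.394–395, Thm 3.1 (3.42) p.397, Thm 3.4 p.400, (3.60)–(3.65) p.402, p.403 ll.3–5, Thm 3.10 (3.107)–(3.108) p.416;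
Balaban1988RG2Cluster, (2.5)–(2.7) pp.12–13, p.15; Balaban1984PropagatorsII, Lemma 2.1 (2.61) p.234] -/
theorem rawEntryLetters_toMatrix_GpY_prodCfg_of_pencil
    (hU : ∀ μ x, ‖(U₀ μ x : 𝔸)‖ ≤ K₀) (hUi : ∀ μ x, ‖(((U₀ μ x)⁻¹ : 𝔸ˣ) : 𝔸)‖ ≤ K₀) (hK1 : 1 ≤ K₀) (hRc : 0 < Rc)
    (hD : ∀ z w, avgCoeffY i z w ≠ 0 →
      Site.tdist ((boxEquiv i.hN).symm z) ((boxEquiv i.hN).symm (cornerY i (levY i z) z)) +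
        Site.tdist ((boxEquiv i.hN).symm (cornerY i (levY i z) z)) ((boxEquiv i.hN).symm w) ≤ D)
    {Cavg : ℝ} (hCavg0 : 0 ≤ Cavg) (hCavg : ∀ z, ∑ w, |avgCoeffY i z w| ≤ Cavg)
    {cb cl : ℝ} (hcb : ∀ (a : 𝔸) (k : κ), ‖b.repr a k‖ ≤ cb * ‖a‖) (hcb0 : 0 ≤ cb) (hcl : ∀ l, ‖b l‖ ≤ cl) (hcl0 : 0 ≤ cl)
    (ℓ' : SiteY i → UT Nf) {s : ℝ} (hs0 : 0 ≤ s)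
    (hℓ : ∀ μ z, tdist1 Nf (ℓ' (shiftY i μ z)) (ℓ' z) ≤ s) (hℓa : ∀ z w, avgCoeffY i z w ≠ 0 → tdist1 Nf (ℓ' z) (ℓ' w) ≤ s)
    {m : ℕ} (hfib : ∀ y : UT Nf, (univ.filter fun p : SiteY i × κ => ℓ' p.1 = y).card ≤ m)
    -- N06's content at the ONE real background `U₀`: invertibility and Theorem 3.1 ∕ 3.10's kernel bound for `G′(U₀)`
    (hunit : IsUnit (deltaPrimeAY i (parSY i) U₀)) {BG ρ : ℝ} (hBG : 0 ≤ BG) (hρ : 0 ≤ ρ)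
    (hO : ∀ x y (E : 𝔸), ‖GpY i (parSY i) U₀ (Pi.single x E) y‖ ≤ BG * ‖E‖ * Real.exp (-(ρ * tdist1 Nf (ℓ' y) (ℓ' x))))
    {ρ' : ℝ} (hρ'0 : 0 ≤ ρ') (hρ' : ρ' < ρ) :
    RawEntryLetters (fun a : Fin (d + 1) → Site (PV d ℓ i.m i.K hd hL) 0 → 𝔸 =>
        LinearMap.toMatrix ((Pi.basis fun _ : SiteY i => b).reindex (Equiv.sigmaEquivProd (SiteY i) κ))
          ((Pi.basis fun _ : SiteY i => b).reindex (Equiv.sigmaEquivProd (SiteY i) κ)) (GpY i (parSY i) (prodCfg U₀ η a)))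
      (fun p : SiteY i × κ => ℓ' p.1)
      (Rc / (4 * ((cb * (((d : ℝ) + 1) *
          (K₀ * Real.exp (|η| * Rc) * (K₀ * Real.exp (|η| * Rc) * cl * (K₀ * Real.exp (|η| * Rc)) + cl) * (K₀ * Real.exp (|η| * Rc)) +
            (K₀ * Real.exp (|η| * Rc) * cl * (K₀ * Real.exp (|η| * Rc)) + cl)) +
          Cavg * ((K₀ * Real.exp (|η| * Rc)) ^ D * cl * (K₀ * Real.exp (|η| * Rc)) ^ D)) * Real.exp (ρ * s)) *
          (cb * cl * BG) * (m * B6.c0 1 ((ρ - ρ') / 3) ^ ν) * (m * B6.c0 1 ((ρ - ρ') / 3) ^ ν)) + 1))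
      ρ' (2 * (cb * cl * BG)) := by
  have hA := rawEntryLetters_toMatrix_deltaPrimeAY_prodCfg i b U₀ η hU hUi hK1 hRc.le hD hCavg0 hCavg hcb hcb0 hcl hcl0 ℓ' hs0 hℓ hℓa hρ
  have h0 : deltaPrimeAY i (parSY i) (prodCfg U₀ η 0) * GpY i (parSY i) U₀ = 1 := by
    rw [prodCfg_zero]
    exact deltaPrimeAY_mul_GpY i (parSY i) U₀ hunit
  exact rawEntryLetters_toMatrix_ringInverse_located_of_kernelBound b (fun a => deltaPrimeAY i (parSY i) (prodCfg U₀ η a)) ℓ' hA h0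
    hcb hcb0 hcl hcl0 hBG hO hfib hRc hρ'0 hρ'

end GreenPrime



end Literature.MathematicalPhysics.QuantumFieldTheory.Balaban1983to89.B13OpsYPencilGreenPrime

end
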